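import Mathlib
import HarnessLib
import Summits.NavierStokesRegularity.NavierStokesRegularity.Theorems.PoloidalWindowRigidity.Negative.TwistingFalseWithoutMild
import Summits.NavierStokesRegularity.NavierStokesRegularity.Theorems.PoloidalWindowRigidity.Negative.HyperbolicThickFalseWithoutMild
import Summits.NavierStokesRegularity.NavierStokesRegularity.Theorems.PoloidalWindowRigidity.Negative.SemiEllipticThickFalseWithoutMild

/-!
# Crux K2 `PoloidalWindowRigidity` (stmt-NavierStokesRegularity-19708) — negative lemmas for the line `congruence_door`
# (skeleton `Cruxes/PoloidalWindowRigidity/Lines/congruence_door.lean` v1, sha16 910287566cb5196e): the three rigidity stubs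
# G1 `stub_congruentHyperbolicTH`, G2 `stub_congruentHyperbolicThick`, G3 `stub_congruentSemiEllipticThick` are FALSE
# WITHOUT the Oseen-mild identity (M)

Negative-side support (refuter seat ns-regularity-refuter1, KILLSHEET K-59; D-0081 §C).  The line `congruence_door`
re-types the research residue of K2: the binders of `mixed_type` v2's three stubs are kept VERBATIM and the conclusion is
WEAKENED from «not backward-singular» to the hypothesis of the (landed) congruence door G0,
«two slices `s < t < 0` are congruent by a Euclidean motion on a nonempty open set:
`∃ s < t < 0, A, b, O ≠ ∅ open, ∀ x ∈ O, v t x = A (v s (A⁻¹(x − b)))`».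

THIS FILE shows that the weakening does not change which hypothesis is load-bearing: with (M) deleted — everything else
VERBATIM — G1, G2 and G3 are false (`congruentHyperbolicTH_false_without_mild`, `congruentHyperbolicThick_false_without_mild`,
`congruentSemiEllipticThick_false_without_mild`).  The witnesses are the tree's (M)-free columns (K-47 twisted (TH) column
`…LrcModEntire.Negative.twistProfile`, K-50 two-mode thick column `…thickProfile`, K-52 semi-elliptic thick column
`…seProfile`), all of the SEPARATED form `v(t, x) = (−t)^{-1/2} V(x)` with `V` bounded, real-analytic and `≢ 0`.  The one new
ingredient is the elementary rigidity lemma `no_congruentSlices_of_separated`: such a profile has NO pair of congruent slices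
on any nonempty open set — by the identity theorem a local congruence `(−t)^{-1/2} V = (−s)^{-1/2} A V∘E⁻¹` on `O` holds on
all of `ℝ³`, so `‖V(E⁻¹x)‖ = κ‖V(x)‖` with `κ = √(s/t) > 1`, and iterating along the orbit `E^{-n} x₀` of a point with
`V(x₀) ≠ 0` contradicts boundedness.  (Slices of a separated profile are congruent UP TO THE SCALING `κ ≠ 1`, never congruent.)
Reading for the lead: as for every earlier column of this crux, (M) must enter G1–G3 STRUCTURALLY; the congruence conclusion is
not reachable from slice kinematics + Type-I rate + analyticity + the pins.
WHAT THIS IS NOT: not a claim about Navier–Stokes regularity and not a refutation of K2 or of G1–G3 as registered (their class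
includes (M)) — a kernel-checked record of which hypothesis is load-bearing. [folklore]
-/

noncomputable section

-- the summit and its single sub-problem share the name (CONVENTIONS §1), as in every Theorems file
set_option linter.dupNamespace false

namespace Summit.NavierStokesRegularity.NavierStokesRegularity.Theorems.PoloidalWindowRigidity.Negative

open MeasureTheory Set Function Filter Topology Metric
open scoped RealInnerProductSpace InnerProductSpace
open Literature.Analysis Literature.Analysis.FluidPDE
open Summit.NavierStokesRegularity.NavierStokesRegularity.Theorems.LrcModEntire.Negative

/-! ## The amplitude `(−t)^{-1/2}` is strictly increasing on `(−∞, 0)` -/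

/-- `cellAmp s < cellAmp t` for `s < t < 0`. [folklore] -/
theorem cellAmp_lt_cellAmp {s t : ℝ} (hst : s < t) (ht : t < 0) : cellAmp s < cellAmp t := by
  have h1 : Real.sqrt (-t) < Real.sqrt (-s) := Real.sqrt_lt_sqrt (by linarith) (by linarith)
  have h2 : 0 < Real.sqrt (-t) := Real.sqrt_pos.2 (by linarith)
  unfold cellAmp
  exact (inv_lt_inv₀ (h2.trans h1) h2).2 h1

/-! ## Separated profiles have no congruent slices -/

/-- **RIGIDITY OF SEPARATED PROFILES.**  If `v(t, x) = (−t)^{-1/2} V(x)` with `V` real-analytic on `ℝ³`, bounded, and not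
identically zero, then no two slices `s < t < 0` of `v` are congruent by a Euclidean motion on a nonempty open set.
Identity theorem ⇒ global congruence ⇒ `‖V(E⁻¹x)‖ = κ‖V x‖`, `κ = cellAmp t / cellAmp s > 1` ⇒ unbounded along an orbit.
[folklore] -/
theorem no_congruentSlices_of_separated {V : (EuclideanSpace ℝ (Fin 3)) → (EuclideanSpace ℝ (Fin 3))} (hVan : AnalyticOnNhd ℝ V univ) {B : ℝ}
    (hB : ∀ x, ‖V x‖ ≤ B) {x₀ : (EuclideanSpace ℝ (Fin 3))} (hx₀ : V x₀ ≠ 0) {v : ℝ → (EuclideanSpace ℝ (Fin 3)) → (EuclideanSpace ℝ (Fin 3))} (hv : ∀ t x, v t x = cellAmp t • V x) :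
    ¬ ∃ s t : ℝ, s < t ∧ t < 0 ∧
        ∃ (A : EuclideanSpace ℝ (Fin 3) ≃ₗᵢ[ℝ] EuclideanSpace ℝ (Fin 3)) (b : EuclideanSpace ℝ (Fin 3))
          (O : Set (EuclideanSpace ℝ (Fin 3))), IsOpen O ∧ O.Nonempty ∧ ∀ x ∈ O, v t x = A (v s (A.symm (x - b))) := by
  rintro ⟨s, t, hst, ht0, A, b, O, hO, ⟨y₀, hy₀⟩, hcongO⟩
  have hs0 : s < 0 := hst.trans ht0
  have hcs : 0 < cellAmp s := cellAmp_pos hs0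
  have hct : 0 < cellAmp t := cellAmp_pos ht0
  have hlt : cellAmp s < cellAmp t := cellAmp_lt_cellAmp hst ht0
  -- the Euclidean motion `E⁻¹ x = A⁻¹ (x − b)`
  set φ : (EuclideanSpace ℝ (Fin 3)) → (EuclideanSpace ℝ (Fin 3)) := fun x => A.symm (x - b) with hφ
  -- ## (1) the congruence holds on all of `ℝ³`
  have hlhs : AnalyticOnNhd ℝ (fun x => cellAmp t • V x) univ :=
    fun y _ => analyticAt_const.fun_smul (hVan y (mem_univ _))
  have hrhs : AnalyticOnNhd ℝ (fun x => cellAmp s • A (V (φ x))) univ := by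
    intro y _
    have hψ : AnalyticAt ℝ φ y :=
      ((A.symm.toContinuousLinearEquiv : (EuclideanSpace ℝ (Fin 3)) →L[ℝ] (EuclideanSpace ℝ (Fin 3))).analyticAt _).comp (analyticAt_id.sub analyticAt_const)
    have h1 : AnalyticAt ℝ (fun x => V (φ x)) y := (hVan _ (mem_univ _)).comp hψ
    exact analyticAt_const.fun_smul (((A.toContinuousLinearEquiv : (EuclideanSpace ℝ (Fin 3)) →L[ℝ] (EuclideanSpace ℝ (Fin 3))).analyticAt _).comp h1)
  have hcongO' : ∀ x ∈ O, cellAmp t • V x = cellAmp s • A (V (φ x)) := by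
    intro x hx
    have h := hcongO x hx
    rw [hv, hv, LinearIsometryEquiv.map_smul] at h
    exact h
  have hcong : ∀ x, cellAmp t • V x = cellAmp s • A (V (φ x)) := by
    have hev : (fun x => cellAmp t • V x) =ᶠ[𝓝 y₀] fun x => cellAmp s • A (V (φ x)) :=
      Filter.eventually_of_mem (hO.mem_nhds hy₀) fun x hx => hcongO' x hx
    have h := hlhs.eqOn_of_preconnected_of_eventuallyEq hrhs isPreconnected_univ (mem_univ y₀) hev
    exact fun x => h (mem_univ x)
  -- ## (2) norms: `cellAmp t ‖V x‖ = cellAmp s ‖V (E⁻¹ x)‖`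
  have hnorm : ∀ x, cellAmp t * ‖V x‖ = cellAmp s * ‖V (φ x)‖ := by
    intro x
    have h := congrArg (fun w : (EuclideanSpace ℝ (Fin 3)) => ‖w‖) (hcong x)
    simp only [norm_smul, Real.norm_of_nonneg hct.le, Real.norm_of_nonneg hcs.le, LinearIsometryEquiv.norm_map] at h
    exact h
  -- ## (3) iterate along the orbit of `x₀`
  set κ : ℝ := cellAmp t / cellAmp s with hκ
  have hκ1 : 1 < κ := (one_lt_div hcs).2 hlt
  have hstep : ∀ x, ‖V (φ x)‖ = κ * ‖V x‖ := by
    intro x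
    have h := hnorm x
    rw [hκ, div_mul_eq_mul_div, eq_div_iff hcs.ne']
    linarith
  have hiter : ∀ n : ℕ, ‖V (φ^[n] x₀)‖ = κ ^ n * ‖V x₀‖ := by
    intro n
    induction n with
    | zero => simp
    | succ n ih => rw [Function.iterate_succ_apply', hstep, ih, pow_succ]; ring
  have hpos : 0 < ‖V x₀‖ := norm_pos_iff.2 hx₀
  obtain ⟨n, hn⟩ := pow_unbounded_of_one_lt (B / ‖V x₀‖) hκ1
  have h1 : B < κ ^ n * ‖V x₀‖ := (div_lt_iff₀ hpos).1 hn
  have h2 := hB (φ^[n] x₀)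
  rw [hiter] at h2
  linarith

/-! ## The three witnesses are separated, bounded, analytic and non-zero -/

/-- The slice `t = −1` of the twisted column is the column field itself (`(−1)^{-1/2} = 1`, tree `cellAmp_neg_one`). [folklore] -/
theorem twistField_eq_twistProfile : twistField = twistProfile (-1) := by
  funext x; simp [twistProfile, cellAmp]

/-- The slice `t = −1` of the thick column is the column field itself. [folklore] -/
theorem thickField_eq_thickProfile : thickField = thickProfile (-1) := by
  funext x; simp [thickProfile, cellAmp]

/-- The twisted column field is real-analytic on `ℝ³`. [folklore] -/
theorem analyticOnNhd_twistField : AnalyticOnNhd ℝ twistField univ := by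
  rw [twistField_eq_twistProfile]; exact analyticOnNhd_twistProfile (-1)

/-- The thick column field is real-analytic on `ℝ³`. [folklore] -/
theorem analyticOnNhd_thickField : AnalyticOnNhd ℝ thickField univ := by
  rw [thickField_eq_thickProfile]; exact analyticOnNhd_thickProfile (-1)

/-- `V(0) = (0, 0, 1/3) ≠ 0` for the twisted column. [folklore] -/
theorem twistField_zero_ne : twistField 0 ≠ 0 := by
  intro h
  have h2 := congrArg (fun w : (EuclideanSpace ℝ (Fin 3)) => w 2) h
  simp only [twistField_apply_two, PiLp.zero_apply, Real.cos_zero, mul_one, twistP_zero, twistQ_zero] at h2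
  norm_num at h2

/-- `V(0) = (0, 0, 2) ≠ 0` for the thick column. [folklore] -/
theorem thickField_zero_ne : thickField 0 ≠ 0 := by
  intro h
  have h2 := congrArg (fun w : (EuclideanSpace ℝ (Fin 3)) => w 2) h
  simp only [thickField_apply_two, PiLp.zero_apply, Real.cos_zero, mul_one, thickP_zero, thickQ_zero] at h2
  norm_num at h2

/-- `ρ(h) = 1/(1+h²)` is real-analytic. [folklore] -/
theorem analyticAt_seRho (h : ℝ) : AnalyticAt ℝ seRho h := by
  have e : seRho = fun y => 1 / (1 + y ^ 2) := rfl
  rw [e]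
  exact analyticAt_const.div (analyticAt_const.add (analyticAt_id.pow 2)) (by positivity)

/-- `ρ₁(h) = −2h/(1+h²)²` is real-analytic. [folklore] -/
theorem analyticAt_seRho₁ (h : ℝ) : AnalyticAt ℝ seRho₁ h := by
  have e : seRho₁ = fun y => -(2 * y) / (1 + y ^ 2) ^ 2 := rfl
  rw [e]
  exact (analyticAt_const.mul analyticAt_id).neg.div ((analyticAt_const.add (analyticAt_id.pow 2)).pow 2) (by positivity)

/-- `arctan` is real-analytic. [folklore] -/
theorem analyticAt_arctan' (h : ℝ) : AnalyticAt ℝ Real.arctan h :=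
  (Real.contDiff_arctan (n := ⊤)).contDiffAt.analyticAt

/-- **The semi-elliptic thick column field is real-analytic on `ℝ³`.** [folklore] -/
theorem analyticOnNhd_seField : AnalyticOnNhd ℝ seField univ := by
  intro x _
  have hY := fun k => analyticAt_coord k x
  have hA0 : AnalyticAt ℝ (fun y : (EuclideanSpace ℝ (Fin 3)) => Real.arctan (y 0)) x := ((analyticAt_arctan' _).comp (hY 0) :)
  have hA1 : AnalyticAt ℝ (fun y : (EuclideanSpace ℝ (Fin 3)) => Real.arctan (y 1)) x := ((analyticAt_arctan' _).comp (hY 1) :)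
  have hA2 : AnalyticAt ℝ (fun y : (EuclideanSpace ℝ (Fin 3)) => Real.arctan (y 2)) x := ((analyticAt_arctan' _).comp (hY 2) :)
  have hR0 : AnalyticAt ℝ (fun y : (EuclideanSpace ℝ (Fin 3)) => seRho (y 0)) x := ((analyticAt_seRho _).comp (hY 0) :)
  have hR2 : AnalyticAt ℝ (fun y : (EuclideanSpace ℝ (Fin 3)) => seRho (y 2)) x := ((analyticAt_seRho _).comp (hY 2) :)
  have hS0 : AnalyticAt ℝ (fun y : (EuclideanSpace ℝ (Fin 3)) => seRho₁ (y 0)) x := ((analyticAt_seRho₁ _).comp (hY 0) :)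
  have hS2 : AnalyticAt ℝ (fun y : (EuclideanSpace ℝ (Fin 3)) => seRho₁ (y 2)) x := ((analyticAt_seRho₁ _).comp (hY 2) :)
  have e : seField = fun x : (EuclideanSpace ℝ (Fin 3)) =>
      (Real.arctan (x 2) + seEps * (seRho (x 0) * seRho₁ (x 2))) • (EuclideanSpace.single (0 : Fin 3) (1 : ℝ) : EuclideanSpace ℝ (Fin 3)) +
        (1 + Real.arctan (x 0) + Real.arctan (x 1) - seEps * (seRho₁ (x 0) * seRho (x 2))) • (EuclideanSpace.single (2 : Fin 3) (1 : ℝ) : EuclideanSpace ℝ (Fin 3)) := rfl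
  rw [e]
  exact ((hA2.add (analyticAt_const.mul (hR0.mul hS2))).smul analyticAt_const).add
    ((((analyticAt_const.add hA0).add hA1).sub (analyticAt_const.mul (hS0.mul hR2))).smul analyticAt_const)

/-- `V(0) = (0, 0, 1) ≠ 0` for the semi-elliptic column. [folklore] -/
theorem seField_zero_ne : seField 0 ≠ 0 := by
  intro h
  have h2 := congrArg (fun w : (EuclideanSpace ℝ (Fin 3)) => w 2) h
  simp only [seField_apply_two, PiLp.zero_apply, Real.arctan_zero, seRho₁_zero, add_zero, zero_mul, mul_zero,
    sub_zero] at h2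
  norm_num at h2

/-- **The twisted (TH) column window is HYPERBOLIC**: `∂₂v₀·∂₀v₂ + ∂₂v₁·∂₁v₂ = (−t)^{-1} m(x₂) (P² sin² x₀ + Q² sin² x₁) < 0`
(`m = twistSlope < 0`). [folklore] -/
theorem twistProfile_hyperbolic (z : ℝ × (EuclideanSpace ℝ (Fin 3))) (hz : z ∈ twistWindow) :
    fderiv ℝ (twistProfile z.1) z.2 (EuclideanSpace.single (2 : Fin 3) (1 : ℝ) : EuclideanSpace ℝ (Fin 3)) 0 * fderiv ℝ (twistProfile z.1) z.2 (EuclideanSpace.single (0 : Fin 3) (1 : ℝ) : EuclideanSpace ℝ (Fin 3)) 2 +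
      fderiv ℝ (twistProfile z.1) z.2 (EuclideanSpace.single (2 : Fin 3) (1 : ℝ) : EuclideanSpace ℝ (Fin 3)) 1 * fderiv ℝ (twistProfile z.1) z.2 (EuclideanSpace.single (1 : Fin 3) (1 : ℝ) : EuclideanSpace ℝ (Fin 3)) 2 < 0 := by
  obtain ⟨ht, hx0, hx0', -, -, hx2, hx2'⟩ := mem_twistWindow hz
  have hc := cellAmp_pos ht
  have hm := twistSlope_neg (z.2 2)
  have ha : 0 < cellAmp z.1 * (twistP (z.2 2) * Real.sin (z.2 0)) :=
    mul_pos hc (mul_pos (twistP_pos hx2 hx2') (Real.sin_pos_of_pos_of_lt_pi hx0 hx0'))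
  rw [fderiv_twistProfile_e2_apply_zero, fderiv_twistProfile_e0_apply_two, fderiv_twistProfile_e2_apply_one,
    fderiv_twistProfile_e1_apply_two]
  have hb : 0 ≤ (cellAmp z.1 * (twistQ (z.2 2) * Real.sin (z.2 1))) ^ 2 := sq_nonneg _
  have key : cellAmp z.1 * -(twistSlope (z.2 2) * twistP (z.2 2) * Real.sin (z.2 0)) *
        (cellAmp z.1 * -(twistP (z.2 2) * Real.sin (z.2 0))) +
      cellAmp z.1 * -(twistSlope (z.2 2) * twistQ (z.2 2) * Real.sin (z.2 1)) *
        (cellAmp z.1 * -(twistQ (z.2 2) * Real.sin (z.2 1))) =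
      twistSlope (z.2 2) * ((cellAmp z.1 * (twistP (z.2 2) * Real.sin (z.2 0))) ^ 2 +
        (cellAmp z.1 * (twistQ (z.2 2) * Real.sin (z.2 1))) ^ 2) := by ring
  rw [key]
  exact mul_neg_of_neg_of_pos hm (by positivity)

/-! ## The three stubs of `congruence_door` without (M) are false -/

/-- **G1 `stub_congruentHyperbolicTH` ∖ (M) is FALSE**: binders VERBATIM with the Oseen-mild identity deleted; the twisted (TH)
column satisfies all of them and has no two congruent slices. [folklore] -/
theorem congruentHyperbolicTH_false_without_mild :
    ¬ (∀ (C : ℝ) (v : ℝ → EuclideanSpace ℝ (Fin 3) → EuclideanSpace ℝ (Fin 3)),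
      Literature.Analysis.FluidPDE.HasTypeITimeDecay C v →
      ContinuousOn (Function.uncurry v) (Set.Iio (0 : ℝ) ×ˢ Set.univ) →
      (∀ t < 0, Literature.Analysis.FluidPDE.VectorCalculus.IsDivFree (v t)) →
      (∀ s < 0, ∀ y, ⟪Literature.Analysis.FluidPDE.curl (v s) y, EuclideanSpace.single 2 1⟫_ℝ = 0) →
      ∀ W : Set (ℝ × EuclideanSpace ℝ (Fin 3)), IsOpen W → W.Nonempty → W ⊆ Set.Iio (0 : ℝ) ×ˢ Set.univ →
        (∀ z ∈ W, Literature.Analysis.FluidPDE.curl (v z.1) z.2 ≠ 0 ∧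
          (fderiv ℝ (v z.1) z.2 (EuclideanSpace.single 0 1) 2 ≠ 0 ∨ fderiv ℝ (v z.1) z.2 (EuclideanSpace.single 1 1) 2 ≠ 0) ∧
          (fderiv ℝ (v z.1) z.2 (EuclideanSpace.single 2 1) 0 ≠ 0 ∨ fderiv ℝ (v z.1) z.2 (EuclideanSpace.single 2 1) 1 ≠ 0)) →
        (∀ m : ℝ → ℝ, ∀ W₁ : Set (ℝ × EuclideanSpace ℝ (Fin 3)), W₁ ⊆ W → IsOpen W₁ → W₁.Nonempty →
          ∃ z ∈ W₁, ∃ b : Fin 3, b ≠ 2 ∧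
            fderiv ℝ (v z.1) z.2 (EuclideanSpace.single 2 1) b ≠
              m z.1 * fderiv ℝ (v z.1) z.2 (EuclideanSpace.single b 1) 2) →
        (∀ z ∈ W,
          fderiv ℝ (fun x => fderiv ℝ (v z.1) x (EuclideanSpace.single 2 1) 2) z.2 (EuclideanSpace.single 0 1) *
              fderiv ℝ (v z.1) z.2 (EuclideanSpace.single 1 1) 2 -
            fderiv ℝ (fun x => fderiv ℝ (v z.1) x (EuclideanSpace.single 2 1) 2) z.2 (EuclideanSpace.single 1 1) *
              fderiv ℝ (v z.1) z.2 (EuclideanSpace.single 0 1) 2 ≠ 0) →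
        (∀ z ∈ W,
          fderiv ℝ (v z.1) z.2 (EuclideanSpace.single 2 1) 0 * fderiv ℝ (v z.1) z.2 (EuclideanSpace.single 0 1) 2 +
            fderiv ℝ (v z.1) z.2 (EuclideanSpace.single 2 1) 1 * fderiv ℝ (v z.1) z.2 (EuclideanSpace.single 1 1) 2 < 0) →
        (∃ m : ℝ → ℝ → ℝ, ∀ z ∈ W, ∀ b : Fin 3, b ≠ 2 →
          fderiv ℝ (v z.1) z.2 (EuclideanSpace.single 2 1) b =
            m z.1 (z.2 2) * fderiv ℝ (v z.1) z.2 (EuclideanSpace.single b 1) 2) →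
        ∃ s t : ℝ, s < t ∧ t < 0 ∧
          ∃ (A : EuclideanSpace ℝ (Fin 3) ≃ₗᵢ[ℝ] EuclideanSpace ℝ (Fin 3)) (b : EuclideanSpace ℝ (Fin 3))
            (O : Set (EuclideanSpace ℝ (Fin 3))), IsOpen O ∧ O.Nonempty ∧ ∀ x ∈ O, v t x = A (v s (A.symm (x - b)))) := by
  intro H
  have h := H 10 twistProfile hasTypeITimeDecay_twistProfile continuousOn_twistProfile
    (fun t _ => isDivFree_twistProfile t) (fun s _ y => poloidal_twistProfile s y) twistWindow isOpen_twistWindow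
    twistWindow_nonempty twistWindow_subset twistProfile_pins
    (fun m W₁ hW₁ hW₁o hW₁n => twistProfile_slope_not_time_only m W₁ hW₁ hW₁o hW₁n)
    twistProfile_twist_ne_zero twistProfile_hyperbolic
    ⟨fun _ h => twistSlope h, fun z _ b hb => twistProfile_timeHeightSlope z b hb⟩
  exact no_congruentSlices_of_separated analyticOnNhd_twistField norm_twistField_le twistField_zero_ne
    (v := twistProfile) (fun _ _ => rfl) h

/-- **G2 `stub_congruentHyperbolicThick` ∖ (M) is FALSE**: binders VERBATIM with (M) deleted; the (non-frozen) two-mode thick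
column satisfies all of them and has no two congruent slices. [folklore] -/
theorem congruentHyperbolicThick_false_without_mild :
    ¬ (∀ (C : ℝ) (v : ℝ → EuclideanSpace ℝ (Fin 3) → EuclideanSpace ℝ (Fin 3)),
      Literature.Analysis.FluidPDE.HasTypeITimeDecay C v →
      ContinuousOn (Function.uncurry v) (Set.Iio (0 : ℝ) ×ˢ Set.univ) →
      (∀ t < 0, Literature.Analysis.FluidPDE.VectorCalculus.IsDivFree (v t)) →
      (∀ s < 0, ∀ y, ⟪Literature.Analysis.FluidPDE.curl (v s) y, EuclideanSpace.single 2 1⟫_ℝ = 0) →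
      ∀ W : Set (ℝ × EuclideanSpace ℝ (Fin 3)), IsOpen W → W.Nonempty → W ⊆ Set.Iio (0 : ℝ) ×ˢ Set.univ →
        (∀ z ∈ W, Literature.Analysis.FluidPDE.curl (v z.1) z.2 ≠ 0 ∧
          (fderiv ℝ (v z.1) z.2 (EuclideanSpace.single 0 1) 2 ≠ 0 ∨ fderiv ℝ (v z.1) z.2 (EuclideanSpace.single 1 1) 2 ≠ 0) ∧
          (fderiv ℝ (v z.1) z.2 (EuclideanSpace.single 2 1) 0 ≠ 0 ∨ fderiv ℝ (v z.1) z.2 (EuclideanSpace.single 2 1) 1 ≠ 0)) →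
        (∀ m : ℝ → ℝ, ∀ W₁ : Set (ℝ × EuclideanSpace ℝ (Fin 3)), W₁ ⊆ W → IsOpen W₁ → W₁.Nonempty →
          ∃ z ∈ W₁, ∃ b : Fin 3, b ≠ 2 ∧
            fderiv ℝ (v z.1) z.2 (EuclideanSpace.single 2 1) b ≠
              m z.1 * fderiv ℝ (v z.1) z.2 (EuclideanSpace.single b 1) 2) →
        (∀ z ∈ W,
          fderiv ℝ (fun x => fderiv ℝ (v z.1) x (EuclideanSpace.single 2 1) 2) z.2 (EuclideanSpace.single 0 1) *
              fderiv ℝ (v z.1) z.2 (EuclideanSpace.single 1 1) 2 -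
            fderiv ℝ (fun x => fderiv ℝ (v z.1) x (EuclideanSpace.single 2 1) 2) z.2 (EuclideanSpace.single 1 1) *
              fderiv ℝ (v z.1) z.2 (EuclideanSpace.single 0 1) 2 ≠ 0) →
        (∀ z ∈ W,
          fderiv ℝ (v z.1) z.2 (EuclideanSpace.single 2 1) 0 * fderiv ℝ (v z.1) z.2 (EuclideanSpace.single 0 1) 2 +
            fderiv ℝ (v z.1) z.2 (EuclideanSpace.single 2 1) 1 * fderiv ℝ (v z.1) z.2 (EuclideanSpace.single 1 1) 2 < 0) →
        (∀ m : ℝ → ℝ → ℝ, ∀ W₁ : Set (ℝ × EuclideanSpace ℝ (Fin 3)), W₁ ⊆ W → IsOpen W₁ → W₁.Nonempty →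
          ∃ z ∈ W₁, ∃ b : Fin 3, b ≠ 2 ∧
            fderiv ℝ (v z.1) z.2 (EuclideanSpace.single 2 1) b ≠
              m z.1 (z.2 2) * fderiv ℝ (v z.1) z.2 (EuclideanSpace.single b 1) 2) →
        ∃ s t : ℝ, s < t ∧ t < 0 ∧
          ∃ (A : EuclideanSpace ℝ (Fin 3) ≃ₗᵢ[ℝ] EuclideanSpace ℝ (Fin 3)) (b : EuclideanSpace ℝ (Fin 3))
            (O : Set (EuclideanSpace ℝ (Fin 3))), IsOpen O ∧ O.Nonempty ∧ ∀ x ∈ O, v t x = A (v s (A.symm (x - b)))) := by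
  intro H
  have h := H 10 thickProfile hasTypeITimeDecay_thickProfile continuousOn_thickProfile
    (fun t _ => isDivFree_thickProfile t) (fun s _ y => poloidal_thickProfile s y) thickWindow isOpen_thickWindow
    thickWindow_nonempty thickWindow_subset thickProfile_pins
    (fun m W₁ hW₁ _ hW₁n => thickProfile_slope_clause_time m W₁ hW₁ hW₁n) thickProfile_twist_ne_zero
    thickProfile_hyperbolic (fun m W₁ hW₁ _ hW₁n => thickProfile_slope_clause_timeHeight m W₁ hW₁ hW₁n)
  exact no_congruentSlices_of_separated analyticOnNhd_thickField norm_thickField_le thickField_zero_ne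
    (v := thickProfile) (fun _ _ => rfl) h

/-- **G3 `stub_congruentSemiEllipticThick` ∖ (M) is FALSE**: binders VERBATIM with (M) deleted; the semi-elliptic thick column
(slab `(−1, 0)`, type scalar `> 0` everywhere) satisfies all of them and has no two congruent slices. [folklore] -/
theorem congruentSemiEllipticThick_false_without_mild :
    ¬ (∀ (C : ℝ) (v : ℝ → EuclideanSpace ℝ (Fin 3) → EuclideanSpace ℝ (Fin 3)),
      Literature.Analysis.FluidPDE.HasTypeITimeDecay C v →
      ContinuousOn (Function.uncurry v) (Set.Iio (0 : ℝ) ×ˢ Set.univ) →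
      (∀ t < 0, Literature.Analysis.FluidPDE.VectorCalculus.IsDivFree (v t)) →
      (∀ s < 0, ∀ y, ⟪Literature.Analysis.FluidPDE.curl (v s) y, EuclideanSpace.single 2 1⟫_ℝ = 0) →
      ∀ W : Set (ℝ × EuclideanSpace ℝ (Fin 3)), IsOpen W → W.Nonempty → W ⊆ Set.Iio (0 : ℝ) ×ˢ Set.univ →
        (∀ z ∈ W, Literature.Analysis.FluidPDE.curl (v z.1) z.2 ≠ 0 ∧
          (fderiv ℝ (v z.1) z.2 (EuclideanSpace.single 0 1) 2 ≠ 0 ∨ fderiv ℝ (v z.1) z.2 (EuclideanSpace.single 1 1) 2 ≠ 0) ∧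
          (fderiv ℝ (v z.1) z.2 (EuclideanSpace.single 2 1) 0 ≠ 0 ∨ fderiv ℝ (v z.1) z.2 (EuclideanSpace.single 2 1) 1 ≠ 0)) →
        (∀ m : ℝ → ℝ, ∀ W₁ : Set (ℝ × EuclideanSpace ℝ (Fin 3)), W₁ ⊆ W → IsOpen W₁ → W₁.Nonempty →
          ∃ z ∈ W₁, ∃ b : Fin 3, b ≠ 2 ∧
            fderiv ℝ (v z.1) z.2 (EuclideanSpace.single 2 1) b ≠
              m z.1 * fderiv ℝ (v z.1) z.2 (EuclideanSpace.single b 1) 2) →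
        (∀ z ∈ W,
          fderiv ℝ (fun x => fderiv ℝ (v z.1) x (EuclideanSpace.single 2 1) 2) z.2 (EuclideanSpace.single 0 1) *
              fderiv ℝ (v z.1) z.2 (EuclideanSpace.single 1 1) 2 -
            fderiv ℝ (fun x => fderiv ℝ (v z.1) x (EuclideanSpace.single 2 1) 2) z.2 (EuclideanSpace.single 1 1) *
              fderiv ℝ (v z.1) z.2 (EuclideanSpace.single 0 1) 2 ≠ 0) →
        ∀ a b : ℝ, W ⊆ Set.Ioo a b ×ˢ Set.univ →
          (∀ s ∈ Set.Ioo a b, ∀ y : EuclideanSpace ℝ (Fin 3),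
            0 ≤ fderiv ℝ (v s) y (EuclideanSpace.single 2 1) 0 * fderiv ℝ (v s) y (EuclideanSpace.single 0 1) 2 +
              fderiv ℝ (v s) y (EuclideanSpace.single 2 1) 1 * fderiv ℝ (v s) y (EuclideanSpace.single 1 1) 2) →
        (∀ m : ℝ → ℝ → ℝ, ∀ W₁ : Set (ℝ × EuclideanSpace ℝ (Fin 3)), W₁ ⊆ W → IsOpen W₁ → W₁.Nonempty →
          ∃ z ∈ W₁, ∃ b : Fin 3, b ≠ 2 ∧
            fderiv ℝ (v z.1) z.2 (EuclideanSpace.single 2 1) b ≠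
              m z.1 (z.2 2) * fderiv ℝ (v z.1) z.2 (EuclideanSpace.single b 1) 2) →
        ∃ s t : ℝ, s < t ∧ t < 0 ∧
          ∃ (A : EuclideanSpace ℝ (Fin 3) ≃ₗᵢ[ℝ] EuclideanSpace ℝ (Fin 3)) (b : EuclideanSpace ℝ (Fin 3))
            (O : Set (EuclideanSpace ℝ (Fin 3))), IsOpen O ∧ O.Nonempty ∧ ∀ x ∈ O, v t x = A (v s (A.symm (x - b)))) := by
  intro H
  have h := H 10 seProfile hasTypeITimeDecay_seProfile continuousOn_seProfile (fun t _ => isDivFree_seProfile t)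
    (fun s _ y => poloidal_seProfile s y) seWindow isOpen_seWindow seWindow_nonempty seWindow_subset seProfile_pins
    (fun m W₁ hW₁ _ hW₁n => seProfile_slope_clause_time m W₁ hW₁ hW₁n) seProfile_twist_ne_zero (-1) 0
    seWindow_subset_slab (fun s _ y => seProfile_type_nonneg s y)
    (fun m W₁ hW₁ _ hW₁n => seProfile_slope_clause_timeHeight m W₁ hW₁ hW₁n)
  exact no_congruentSlices_of_separated analyticOnNhd_seField norm_seField_le seField_zero_ne
    (v := seProfile) (fun _ _ => rfl) h

end Summit.NavierStokesRegularity.NavierStokesRegularity.Theorems.PoloidalWindowRigidity.Negative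

end
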